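import Summits.QuantumFields.GaugeBoot.BootstrapDiagonalRPWitness
import Summits.QuantumFields.GaugeBoot.BootstrapAllCuts
import Summits.QuantumFields.GaugeBoot.GaugeInvariantBootstrapConvergence
import Summits.QuantumFields.GaugeBoot.DiagonalRPTorusEvenGaugeInvariantAllGroups
import HarnessLib

/-!
# Reflection positivity as bootstrap cuts III: the DIAGONAL family — inconsistent on tori of
dimension `≥ 3`, sound in two dimensions (gauge-boot, L3 ↔ L1)

HONEST FRAMING (cell `pub-gaugeboot`, page 1 of every file): the venture produces certified bounds
on lattice expectations at stated coupling, gauge group, dimension and torus size; NOT a mass gap,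
NOT a continuum limit, NOT a string tension; NOT Yang–Mills-summit-bearing (barriers
`FixedCouplingUltralocality`, `PerturbativeInvisibility`). Structural; it certifies no number.
It says which positivity constraints a TORUS bootstrap may impose; nothing else.

## Content

The third Kazakov–Zheng family of reflection-positivity matrices (arXiv:2203.11360 §3.1: mirrors
`x_i = x_j`, observables of the closed half `x_i ≥ x_j`, e.g. Wilson loops inside it) transplanted
to the torus `(ℤ/L)^d` (`IsDiagonalHalfObservable`, `configDiagSwap`; cell task L3). For the
word-level-`n` `SU(N)` bootstrap (`IsBootstrapFeasible` on `wordTruncation n`: normalisation,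
moment-matrix positivity, loop equations) the DIAGONAL CUTS are the constraints
`0 ≤ φ ((v ∘ Θ_{ij}) · v)` for level-`n` test functions `v` that are gauge invariant and supported in
the closed diagonal half (`diagRpLevelValuesSuN`). Unlike the site and link families
(`BootstrapReflectionPositivity`, `BootstrapLinkReflectionPositivity`, `BootstrapAllCuts`: sound at
every level, even `L`, `β ≥ 0`), this family depends on the DIMENSION:

* ★★★ `exists_diagCut_neg_of_bootstrap_suN` (`_uN`, and `_of_gaugeInvariantBootstrap_suN` for the
  bootstrap on gauge-invariant data) — `d ≥ 3` (pairwise distinct `i, j, m`), `L` even, ANY real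
  `β`, `N ≥ 2`: EVERY solution of the untruncated bootstrap VIOLATES a diagonal cut: there is a
  gauge-invariant closed-half polynomial `f` (a difference of two Polyakov loops) with
  `φ ((f ∘ Θ_{ij}) f) < 0` — because the solution is the Wilson expectation
  (`eq_wilson_of_bootstrap_suN`) and the torus Wilson measure is not diagonally RP
  (`exists_poly_diagSwap_witness`);
* ★★★ `diagCuts_eventually_infeasible_suN` (`_uN`, `_gaugeInvariantBootstrap_suN`),
  `diagRpLevelValues_eventually_eq_empty_suN` — consequently the word-level-`n` SDP WITH the
  diagonal cuts is INFEASIBLE for all large `n` (the truncated bootstrap converges,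
  `bootstrap_convergence_words_suN`, so `φ((f∘Θ)f) → W < 0` uniformly over the feasible sets while the
  cut demands `≥ 0`): on a torus of dimension `≥ 3` a bound derived with diagonal-RP blocks is a
  bound over an eventually EMPTY set; ★★ `allCuts_consistent_diagCuts_inconsistent_suN` — contrast
  with the other cuts, whose feasible sets contain the Wilson value at every level;
* ★★★ `giDiagRP_of_bootstrap_two_suN`, `wilson_mem_diagRpLevelValues_two_suN`,
  `diagCuts_two_sound_and_convergent_suN` — `d = 2`, `L ≥ 4` EVEN, ANY real `β`, every `N`: the
  gauge-invariant diagonal cuts ARE consequences of the untruncated system and the SDP with them is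
  a sound convergent relaxation (`DiagRPTwo.gaugeInvariantDiagonalRP_two_even_allBeta_suN`);
  ★★ `diagRP_of_bootstrap_two_odd_suN` — `d = 2`, `L ≥ 3` ODD, `β ≥ 0`, `N ≥ 2`: even the
  gauge-variant closed-half cuts are consequences (`DiagRPTwo.diagonalReflectionPositive_two_iff_suN`).

So, for the cell's torus certificates (`D = 3, 4`, even `L`): the Class-A block list (moment
matrix, site-RP, link-RP) is exactly right; a diagonal block would make the SDP infeasible at high
level. On `ℤ^d` / free boxes diagonal RP holds (`DiagonalRPFreeBox`, Class B) — that is the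
setting of Kazakov–Zheng's own usage; nothing here concerns it.

What this is NOT: odd tori in `d ≥ 3` (there diagonal RP fails only for small `β > 0`,
`DiagRPRest.diagonalRP_fails_suN`, with an `L`-dependent window; not restated here); the level `n₀`
from which the SDP is infeasible (no rate); `ℤ^d`.

References: V. Kazakov, Z. Zheng, arXiv:2203.11360 §3.1; P. Anderson, M. Kruczenski, Nucl. Phys.
B 921 (2017); K. Osterwalder, E. Seiler, Ann. Phys. 110 (1978) 440 §2; J. Fröhlich, R. Israel,
E. H. Lieb, B. Simon, J. Stat. Phys. 22 (1980) 297 §3 (periodic b.c. and diagonal RP, spin systems).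
Folklore-level; not in print as theorems as far as the cell's searches go.
-/

noncomputable section

open MeasureTheory Filter Topology NormedSpace
open scoped ComplexOrder
open Literature.MathematicalPhysics.QuantumFieldTheory (LatticeRep Site Edge GaugeConfig IsGaugeInvariant wilsonAction
  wilsonMeasure isProbabilityMeasure_wilsonMeasure)

namespace Summit.QuantumFields.GaugeBoot

open Literature.MathematicalPhysics.QuantumLattice

/-! ## Non-constant characters of the defining representations -/

section Character

variable (N : ℕ)

/-- `SU(N)`, `N ≥ 2`: the character of the defining representation is not constant. -/
theorem exists_re_trace_fundamentalRep_ne (hN : 2 ≤ N) :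
    ∃ g : Matrix.specialUnitaryGroup (Fin N) ℂ, ((fundamentalRep (Fin N) g).trace).re ≠ N := by
  obtain ⟨g, hg⟩ := TiltedRP.exists_fundamentalRep_ne_one hN
  exact ⟨g, re_trace_ne_card_of_ne_one (fundamentalRep (Fin N)) (continuous_fundamentalRep _) hg⟩

/-- `U(N)`, `N ≥ 1`: the character of the defining representation is not constant. -/
theorem exists_re_trace_unitaryFundamentalRep_ne (hN : 1 ≤ N) :
    ∃ g : Matrix.unitaryGroup (Fin N) ℂ, ((unitaryFundamentalRep (Fin N) ℂ g).trace).re ≠ N := by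
  obtain ⟨g, hg⟩ := TiltedRP.exists_unitaryFundamentalRep_ne_one hN
  exact ⟨g, re_trace_ne_card_of_ne_one (unitaryFundamentalRep (Fin N) ℂ)
    (continuous_unitaryFundamentalRep _ _) hg⟩

end Character

/-! ## Tori of dimension `≥ 3`: every solution violates the diagonal cuts -/

section Negative

variable {d L : ℕ} [NeZero L] (N : ℕ) (β : ℝ)

/-- ★★★ **`SU(N)`, `N ≥ 2`, torus `(ℤ/L)^d` with three pairwise distinct directions `i, j, m`, `L`
even, ANY real `β`: every solution of the untruncated bootstrap VIOLATES a diagonal-RP cut** — there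
is a gauge-invariant polynomial observable `f` of the closed diagonal half `{0 ≤ (y_i-y_j) mod L ≤ L/2}`
with `φ ((f ∘ Θ_{ij}) · f) < 0`. [folklore] -/
theorem exists_diagCut_neg_of_bootstrap_suN (hN : 2 ≤ N) (hL : Even L) {i j m : Fin d} (hij : i ≠ j)
    (hmi : m ≠ i) (hmj : m ≠ j)
    {φ : C(GaugeConfig d L (Matrix.specialUnitaryGroup (Fin N) ℂ), ℝ) →ₗ[ℝ] ℝ} (h1 : φ 1 = 1)
    (hpos : ∀ a ∈ polyAlgebra (ι := Edge d L) (fundamentalLatticeRep N), 0 ≤ φ (a * a))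
    (hφ : IsSDFunctional (fundamentalLatticeRep N) (suExp N) (fun _ => wilsonAction (fundamentalRep (Fin N))) β φ) :
    ∃ f ∈ polyAlgebra (ι := Edge d L) (fundamentalLatticeRep N),
      IsDiagonalHalfObservable i j (⇑f) ∧ IsGaugeInvariant (⇑f) ∧ φ (f.comp (diagSwapCM i j) * f) < 0 := by
  obtain ⟨f, hf, hfH, hfg, -, hneg⟩ := exists_poly_diagSwap_witness (fundamentalLatticeRep N) hL
    (exists_re_trace_fundamentalRep_ne N hN) β hij hmi hmj
  have hneg' : ∫ U, f (configDiagSwap i j U) * f U ∂(wilsonMeasure (fundamentalRep (Fin N)) β) < 0 := hneg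
  refine ⟨f, hf, hfH, hfg, ?_⟩
  rw [eq_wilson_of_bootstrap_suN N β h1 hpos hφ
    (Subalgebra.mul_mem _ (comp_diagSwapCM_mem_polyAlgebra _ i j hf) hf)]
  simpa only [ContinuousMap.mul_apply, ContinuousMap.comp_apply, diagSwapCM_apply] using hneg'

/-- ★★★ **`U(N)`, `N ≥ 1` (shifts `e^{tX}`, `X ∈ 𝔲(N)`): every solution of the untruncated bootstrap
violates a diagonal-RP cut** (`d ≥ 3`, `L` even, any real `β`). [folklore] -/
theorem exists_diagCut_neg_of_bootstrap_uN (hN : 1 ≤ N) (hL : Even L) {i j m : Fin d} (hij : i ≠ j)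
    (hmi : m ≠ i) (hmj : m ≠ j)
    {φ : C(GaugeConfig d L (Matrix.unitaryGroup (Fin N) ℂ), ℝ) →ₗ[ℝ] ℝ} (h1 : φ 1 = 1)
    (hpos : ∀ a ∈ polyAlgebra (ι := Edge d L) (unitaryFundamentalLatticeRep N), 0 ≤ φ (a * a))
    (hφ : IsSDFunctional (unitaryFundamentalLatticeRep N) (uExp N)
      (fun _ => wilsonAction (unitaryFundamentalRep (Fin N) ℂ)) β φ) :
    ∃ f ∈ polyAlgebra (ι := Edge d L) (unitaryFundamentalLatticeRep N),
      IsDiagonalHalfObservable i j (⇑f) ∧ IsGaugeInvariant (⇑f) ∧ φ (f.comp (diagSwapCM i j) * f) < 0 := by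
  obtain ⟨f, hf, hfH, hfg, -, hneg⟩ := exists_poly_diagSwap_witness (unitaryFundamentalLatticeRep N) hL
    (exists_re_trace_unitaryFundamentalRep_ne N hN) β hij hmi hmj
  have hneg' : ∫ U, f (configDiagSwap i j U) * f U ∂(wilsonMeasure (unitaryFundamentalRep (Fin N) ℂ) β) < 0 :=
    hneg
  refine ⟨f, hf, hfH, hfg, ?_⟩
  rw [eq_wilson_of_bootstrap_uN N β h1 hpos hφ
    (Subalgebra.mul_mem _ (comp_diagSwapCM_mem_polyAlgebra _ i j hf) hf)]
  simpa only [ContinuousMap.mul_apply, ContinuousMap.comp_apply, diagSwapCM_apply] using hneg'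

/-- ★★★ **The bootstrap on GAUGE-INVARIANT DATA (Wilson loops; loop positivity, gauge-averaged loop
equations) also violates a diagonal cut** — `SU(N)`, `N ≥ 2`, `d ≥ 3`, `L` even, any real `β`: for
every solution `ψ` there is a gauge-invariant closed-half polynomial `f` with `ψ ((f ∘ Θ_{ij}) · f) < 0`.
[folklore] -/
theorem exists_diagCut_neg_of_gaugeInvariantBootstrap_suN (hN : 2 ≤ N) (hL : Even L) {i j m : Fin d}
    (hij : i ≠ j) (hmi : m ≠ i) (hmj : m ≠ j)
    {ψ : C(GaugeConfig d L (Matrix.specialUnitaryGroup (Fin N) ℂ), ℝ) →ₗ[ℝ] ℝ} (h1 : ψ 1 = 1)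
    (hpos : ∀ a ∈ polyAlgebra (ι := Edge d L) (fundamentalLatticeRep N),
      0 ≤ ψ (gaugeAvgL d L _ (a * a)))
    (hψ : IsSDFunctional (fundamentalLatticeRep N) (suExp N)
      (fun _ => wilsonAction (fundamentalRep (Fin N))) β (ψ ∘ₗ gaugeAvgL d L _)) :
    ∃ f ∈ polyAlgebra (ι := Edge d L) (fundamentalLatticeRep N),
      IsDiagonalHalfObservable i j (⇑f) ∧ IsGaugeInvariant (⇑f) ∧ ψ (f.comp (diagSwapCM i j) * f) < 0 := by
  obtain ⟨f, hf, hfH, hfg, hodd, hneg⟩ := exists_poly_diagSwap_witness (fundamentalLatticeRep N) hL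
    (exists_re_trace_fundamentalRep_ne N hN) β hij hmi hmj
  have hneg' : ∫ U, f (configDiagSwap i j U) * f U ∂(wilsonMeasure (fundamentalRep (Fin N)) β) < 0 := hneg
  refine ⟨f, hf, hfH, hfg, ?_⟩
  have hQi : IsGaugeInvariant (⇑(f.comp (diagSwapCM i j) * f)) := fun g U => by
    simp only [ContinuousMap.mul_apply, ContinuousMap.comp_apply, diagSwapCM_apply, hodd, hfg g U]
  rw [eq_wilson_of_gaugeInvariantBootstrap_suN N β h1 hpos hψ
    (Subalgebra.mul_mem _ (comp_diagSwapCM_mem_polyAlgebra _ i j hf) hf) hQi]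
  simpa only [ContinuousMap.mul_apply, ContinuousMap.comp_apply, diagSwapCM_apply] using hneg'

/-! ## The truncated SDP with diagonal cuts is eventually infeasible (`d ≥ 3`) -/

/-- **The level-`n` feasible values of `P` with the DIAGONAL-RP cuts of the mirror `x_i = x_j`
added**: level-`n` feasible functionals (`IsBootstrapFeasible` on the words of length `≤ n`) with
`0 ≤ φ ((v ∘ Θ_{ij}) · v)` for every level-`n` test function `v` that is gauge invariant and an
observable of the closed diagonal half (Kazakov–Zheng's third reflection family, on the torus).
[folklore] -/
def diagRpLevelValuesSuN (i j : Fin d) (n : ℕ)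
    (P : C(GaugeConfig d L (Matrix.specialUnitaryGroup (Fin N) ℂ), ℝ)) : Set ℝ :=
  {t | ∃ φ : C(GaugeConfig d L (Matrix.specialUnitaryGroup (Fin N) ℂ), ℝ) →ₗ[ℝ] ℝ,
    IsBootstrapFeasible (fundamentalLatticeRep N) (suExp N)
        (fun _ => wilsonAction (fundamentalRep (Fin N))) β
        (wordTruncation (ι := Edge d L) (fundamentalLatticeRep N) n) φ ∧
      (∀ v ∈ wordTruncation (ι := Edge d L) (fundamentalLatticeRep N) n,
        IsDiagonalHalfObservable i j (⇑v) → IsGaugeInvariant (⇑v) →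
          0 ≤ φ (v.comp (diagSwapCM i j) * v)) ∧
      φ P = t}

/-- The diagonal cuts shrink the feasible set of the plain word truncation. -/
theorem diagRpLevelValues_subset_levelValues (i j : Fin d) (n : ℕ)
    (P : C(GaugeConfig d L (Matrix.specialUnitaryGroup (Fin N) ℂ), ℝ)) :
    diagRpLevelValuesSuN (d := d) (L := L) N β i j n P ⊆ levelValuesSuN (d := d) (L := L) N β n P := by
  rintro t ⟨φ, hφ, -, rfl⟩
  exact ⟨φ, hφ, rfl⟩

/-- ★★★ **On a torus of dimension `≥ 3` the word-level SDP with diagonal-RP cuts is eventually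
INFEASIBLE** (`SU(N)`, `N ≥ 2`; pairwise distinct `i, j, m`; `L` even; ANY real `β`): for all large
`n`, NO level-`n` feasible functional satisfies the diagonal cuts of the mirror `x_i = x_j` — not even
those with gauge-invariant test functions. [folklore] -/
theorem diagCuts_eventually_infeasible_suN (hN : 2 ≤ N) (hL : Even L) {i j m : Fin d} (hij : i ≠ j)
    (hmi : m ≠ i) (hmj : m ≠ j) :
    ∀ᶠ n in atTop, ∀ φ : C(GaugeConfig d L (Matrix.specialUnitaryGroup (Fin N) ℂ), ℝ) →ₗ[ℝ] ℝ,
      IsBootstrapFeasible (fundamentalLatticeRep N) (suExp N)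
          (fun _ => wilsonAction (fundamentalRep (Fin N))) β
          (wordTruncation (ι := Edge d L) (fundamentalLatticeRep N) n) φ →
        ¬ ∀ v ∈ wordTruncation (ι := Edge d L) (fundamentalLatticeRep N) n,
            IsDiagonalHalfObservable i j (⇑v) → IsGaugeInvariant (⇑v) →
              0 ≤ φ (v.comp (diagSwapCM i j) * v) := by
  obtain ⟨f, hf, hfH, hfg, -, hneg⟩ := exists_poly_diagSwap_witness (fundamentalLatticeRep N) hL
    (exists_re_trace_fundamentalRep_ne N hN) β hij hmi hmj
  have hneg' : ∫ U, f (configDiagSwap i j U) * f U ∂(wilsonMeasure (fundamentalRep (Fin N)) β) < 0 := hneg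
  have hQ : f.comp (diagSwapCM i j) * f ∈ polyAlgebra (ι := Edge d L) (fundamentalLatticeRep N) :=
    Subalgebra.mul_mem _ (comp_diagSwapCM_mem_polyAlgebra _ i j hf) hf
  have hW : ∫ U, (f.comp (diagSwapCM i j) * f) U ∂(wilsonMeasure (fundamentalRep (Fin N)) β) < 0 := by
    simpa only [ContinuousMap.mul_apply, ContinuousMap.comp_apply, diagSwapCM_apply] using hneg'
  filter_upwards [eventually_mem_wordTruncation (fundamentalLatticeRep N) hf,
    bootstrap_convergence_words_suN (d := d) (L := L) N β hQ
      (ε := -(∫ U, (f.comp (diagSwapCM i j) * f) U ∂(wilsonMeasure (fundamentalRep (Fin N)) β)) / 2)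
      (by linarith)] with n hfn hconv φ hφ hcut
  have h0 := hcut f hfn hfH hfg
  have h2 := (abs_le.1 (hconv φ hφ)).2
  linarith

/-- ★★★ **Corollary: for every observable `P` the feasible values with diagonal cuts form the EMPTY
set at all large levels** (`SU(N)`, `N ≥ 2`, `d ≥ 3`, even `L`, any real `β`). [folklore] -/
theorem diagRpLevelValues_eventually_eq_empty_suN (hN : 2 ≤ N) (hL : Even L) {i j m : Fin d}
    (hij : i ≠ j) (hmi : m ≠ i) (hmj : m ≠ j)
    (P : C(GaugeConfig d L (Matrix.specialUnitaryGroup (Fin N) ℂ), ℝ)) :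
    ∀ᶠ n in atTop, diagRpLevelValuesSuN (d := d) (L := L) N β i j n P = ∅ := by
  filter_upwards [diagCuts_eventually_infeasible_suN (d := d) (L := L) N β hN hL hij hmi hmj] with n hn
  exact Set.eq_empty_iff_forall_notMem.2 fun t ⟨φ, hφ, hcut, _⟩ => hn φ hφ hcut

/-- ★★★ **`U(N)`, `N ≥ 1`: the word-level SDP with diagonal cuts is eventually infeasible**
(`d ≥ 3`, even `L`, any real `β`). [folklore] -/
theorem diagCuts_eventually_infeasible_uN (hN : 1 ≤ N) (hL : Even L) {i j m : Fin d} (hij : i ≠ j)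
    (hmi : m ≠ i) (hmj : m ≠ j) :
    ∀ᶠ n in atTop, ∀ φ : C(GaugeConfig d L (Matrix.unitaryGroup (Fin N) ℂ), ℝ) →ₗ[ℝ] ℝ,
      IsBootstrapFeasible (unitaryFundamentalLatticeRep N) (uExp N)
          (fun _ => wilsonAction (unitaryFundamentalRep (Fin N) ℂ)) β
          (wordTruncation (ι := Edge d L) (unitaryFundamentalLatticeRep N) n) φ →
        ¬ ∀ v ∈ wordTruncation (ι := Edge d L) (unitaryFundamentalLatticeRep N) n,
            IsDiagonalHalfObservable i j (⇑v) → IsGaugeInvariant (⇑v) →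
              0 ≤ φ (v.comp (diagSwapCM i j) * v) := by
  obtain ⟨f, hf, hfH, hfg, -, hneg⟩ := exists_poly_diagSwap_witness (unitaryFundamentalLatticeRep N) hL
    (exists_re_trace_unitaryFundamentalRep_ne N hN) β hij hmi hmj
  have hneg' : ∫ U, f (configDiagSwap i j U) * f U ∂(wilsonMeasure (unitaryFundamentalRep (Fin N) ℂ) β) < 0 :=
    hneg
  have hQ : f.comp (diagSwapCM i j) * f ∈ polyAlgebra (ι := Edge d L) (unitaryFundamentalLatticeRep N) :=
    Subalgebra.mul_mem _ (comp_diagSwapCM_mem_polyAlgebra _ i j hf) hf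
  have hW : ∫ U, (f.comp (diagSwapCM i j) * f) U ∂(wilsonMeasure (unitaryFundamentalRep (Fin N) ℂ) β) < 0 := by
    simpa only [ContinuousMap.mul_apply, ContinuousMap.comp_apply, diagSwapCM_apply] using hneg'
  filter_upwards [eventually_mem_wordTruncation (unitaryFundamentalLatticeRep N) hf,
    bootstrap_convergence_words_uN (d := d) (L := L) N β hQ
      (ε := -(∫ U, (f.comp (diagSwapCM i j) * f) U ∂(wilsonMeasure (unitaryFundamentalRep (Fin N) ℂ) β)) / 2)
      (by linarith)] with n hfn hconv φ hφ hcut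
  have h0 := hcut f hfn hfH hfg
  have h2 := (abs_le.1 (hconv φ hφ)).2
  linarith

/-- ★★ **The same for the bootstrap on gauge-invariant data** (`SU(N)`, `N ≥ 2`, `d ≥ 3`, even `L`,
any real `β`): for all large `n`, no functional `ψ` whose gauge-invariant extension `ψ ∘ A` is
level-`n` feasible satisfies the diagonal cuts. [folklore] -/
theorem diagCuts_eventually_infeasible_gaugeInvariantBootstrap_suN (hN : 2 ≤ N) (hL : Even L)
    {i j m : Fin d} (hij : i ≠ j) (hmi : m ≠ i) (hmj : m ≠ j) :
    ∀ᶠ n in atTop, ∀ ψ : C(GaugeConfig d L (Matrix.specialUnitaryGroup (Fin N) ℂ), ℝ) →ₗ[ℝ] ℝ,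
      IsBootstrapFeasible (fundamentalLatticeRep N) (suExp N)
          (fun _ => wilsonAction (fundamentalRep (Fin N))) β
          (wordTruncation (ι := Edge d L) (fundamentalLatticeRep N) n) (ψ ∘ₗ gaugeAvgL d L _) →
        ¬ ∀ v ∈ wordTruncation (ι := Edge d L) (fundamentalLatticeRep N) n,
            IsDiagonalHalfObservable i j (⇑v) → IsGaugeInvariant (⇑v) →
              0 ≤ ψ (v.comp (diagSwapCM i j) * v) := by
  obtain ⟨f, hf, hfH, hfg, hodd, hneg⟩ := exists_poly_diagSwap_witness (fundamentalLatticeRep N) hL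
    (exists_re_trace_fundamentalRep_ne N hN) β hij hmi hmj
  have hneg' : ∫ U, f (configDiagSwap i j U) * f U ∂(wilsonMeasure (fundamentalRep (Fin N)) β) < 0 := hneg
  have hQ : f.comp (diagSwapCM i j) * f ∈ polyAlgebra (ι := Edge d L) (fundamentalLatticeRep N) :=
    Subalgebra.mul_mem _ (comp_diagSwapCM_mem_polyAlgebra _ i j hf) hf
  have hQi : IsGaugeInvariant (⇑(f.comp (diagSwapCM i j) * f)) := fun g U => by
    simp only [ContinuousMap.mul_apply, ContinuousMap.comp_apply, diagSwapCM_apply, hodd, hfg g U]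
  have hW : ∫ U, (f.comp (diagSwapCM i j) * f) U ∂(wilsonMeasure (fundamentalRep (Fin N)) β) < 0 := by
    simpa only [ContinuousMap.mul_apply, ContinuousMap.comp_apply, diagSwapCM_apply] using hneg'
  filter_upwards [eventually_mem_wordTruncation (fundamentalLatticeRep N) hf,
    gaugeInvariantBootstrap_convergence_words_suN (d := d) (L := L) N β hQ hQi
      (ε := -(∫ U, (f.comp (diagSwapCM i j) * f) U ∂(wilsonMeasure (fundamentalRep (Fin N)) β)) / 2)
      (by linarith)] with n hfn hconv ψ hψ hcut
  have h0 := hcut f hfn hfH hfg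
  have h2 := (abs_le.1 (hconv ψ hψ)).2
  linarith

/-- ★★ **Contrast** (`SU(N)`, `N ≥ 2`, even `L`, `β ≥ 0`, a torus of dimension `≥ 3`): the SDP with
ALL OTHER standard cuts (moment matrix, loop equations, lattice and internal symmetries, site-RP,
link-RP) keeps the Wilson value feasible at EVERY level, while the diagonal cuts alone empty the
feasible set at all large levels. [folklore] -/
theorem allCuts_consistent_diagCuts_inconsistent_suN [NeZero d] (hN : 2 ≤ N) (hL : Even L) (hβ : 0 ≤ β)
    {i j m : Fin d} (hij : i ≠ j) (hmi : m ≠ i) (hmj : m ≠ j)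
    (P : C(GaugeConfig d L (Matrix.specialUnitaryGroup (Fin N) ℂ), ℝ)) :
    (∀ n, ∫ U, P U ∂(wilsonMeasure (fundamentalRep (Fin N)) β) ∈ allCutsLevelValuesSuN (d := d) (L := L) N β n P) ∧
      ∀ᶠ n in atTop, diagRpLevelValuesSuN (d := d) (L := L) N β i j n P = ∅ :=
  ⟨fun n => wilson_mem_allCutsLevelValues_suN N β hL hβ n P,
    diagRpLevelValues_eventually_eq_empty_suN N β hN hL hij hmi hmj P⟩

/-- In every dimension the diagonal cuts shrink the feasible set, so the (possibly empty) feasible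
values still lie eventually within `ε` of the Wilson value. -/
theorem diagRpLevelValues_subset_Icc_suN (i j : Fin d) {P : C(GaugeConfig d L (Matrix.specialUnitaryGroup (Fin N) ℂ), ℝ)}
    (hP : P ∈ polyAlgebra (ι := Edge d L) (fundamentalLatticeRep N)) {ε : ℝ} (hε : 0 < ε) :
    ∀ᶠ n in atTop, diagRpLevelValuesSuN (d := d) (L := L) N β i j n P ⊆
      Set.Icc (∫ U, P U ∂(wilsonMeasure (fundamentalRep (Fin N)) β) - ε)
        (∫ U, P U ∂(wilsonMeasure (fundamentalRep (Fin N)) β) + ε) := by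
  filter_upwards [levelValues_subset_Icc_suN N β hP hε] with n hn
  exact (diagRpLevelValues_subset_levelValues N β i j n P).trans hn

end Negative

/-! ## Two dimensions: the diagonal cuts are consequences -/

section TwoDim

variable {L : ℕ} [NeZero L] (N : ℕ) (β : ℝ)

/-- ★★★ **`d = 2`, `L ≥ 4` even, ANY real `β`, every `SU(N)`: every solution of the untruncated
bootstrap satisfies the gauge-invariant diagonal cuts** — `0 ≤ φ ((f ∘ Θ_{ij}) · f)` for every
gauge-invariant polynomial observable `f` of the closed diagonal half. [folklore] -/
theorem giDiagRP_of_bootstrap_two_suN (hL : Even L) (h4 : 4 ≤ L) {i j : Fin 2} (hij : i ≠ j)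
    {φ : C(GaugeConfig 2 L (Matrix.specialUnitaryGroup (Fin N) ℂ), ℝ) →ₗ[ℝ] ℝ} (h1 : φ 1 = 1)
    (hpos : ∀ a ∈ polyAlgebra (ι := Edge 2 L) (fundamentalLatticeRep N), 0 ≤ φ (a * a))
    (hφ : IsSDFunctional (fundamentalLatticeRep N) (suExp N) (fun _ => wilsonAction (fundamentalRep (Fin N))) β φ)
    {f : C(GaugeConfig 2 L (Matrix.specialUnitaryGroup (Fin N) ℂ), ℝ)}
    (hf : f ∈ polyAlgebra (ι := Edge 2 L) (fundamentalLatticeRep N))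
    (hfH : IsDiagonalHalfObservable i j (⇑f)) (hfg : IsGaugeInvariant (⇑f)) :
    0 ≤ φ (f.comp (diagSwapCM i j) * f) := by
  rw [eq_wilson_of_bootstrap_suN N β h1 hpos hφ
    (Subalgebra.mul_mem _ (comp_diagSwapCM_mem_polyAlgebra _ i j hf) hf)]
  simpa only [ContinuousMap.mul_apply, ContinuousMap.comp_apply, diagSwapCM_apply] using
    wilson_giDiagRP_real (fundamentalRep (Fin N))
      (DiagRPTwo.gaugeInvariantDiagonalRP_two_even_allBeta_suN hL h4 hij β) f hfH hfg

/-- ★★ **`d = 2`, `L ≥ 3` ODD, `β ≥ 0`, `SU(N)` with `N ≥ 2`: every solution satisfies ALL closed-half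
diagonal cuts**, gauge-variant test functions included. [folklore] -/
theorem diagRP_of_bootstrap_two_odd_suN (hO : Odd L) (h3 : 3 ≤ L) (hN : 2 ≤ N) (hβ : 0 ≤ β)
    {i j : Fin 2} (hij : i ≠ j)
    {φ : C(GaugeConfig 2 L (Matrix.specialUnitaryGroup (Fin N) ℂ), ℝ) →ₗ[ℝ] ℝ} (h1 : φ 1 = 1)
    (hpos : ∀ a ∈ polyAlgebra (ι := Edge 2 L) (fundamentalLatticeRep N), 0 ≤ φ (a * a))
    (hφ : IsSDFunctional (fundamentalLatticeRep N) (suExp N) (fun _ => wilsonAction (fundamentalRep (Fin N))) β φ)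
    {f : C(GaugeConfig 2 L (Matrix.specialUnitaryGroup (Fin N) ℂ), ℝ)}
    (hf : f ∈ polyAlgebra (ι := Edge 2 L) (fundamentalLatticeRep N))
    (hfH : IsDiagonalHalfObservable i j (⇑f)) :
    0 ≤ φ (f.comp (diagSwapCM i j) * f) := by
  rw [eq_wilson_of_bootstrap_suN N β h1 hpos hφ
    (Subalgebra.mul_mem _ (comp_diagSwapCM_mem_polyAlgebra _ i j hf) hf)]
  simpa only [ContinuousMap.mul_apply, ContinuousMap.comp_apply, diagSwapCM_apply] using
    wilson_diagRP_real (fundamentalRep (Fin N))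
      ((DiagRPTwo.diagonalReflectionPositive_two_iff_suN hN h3 β hij).2 (Or.inl ⟨hO, hβ⟩)) f hfH

/-- ★★ **`d = 2`, `L ≥ 4` even, any real `β`: the Wilson value satisfies the diagonal cuts at every
level** — the two-dimensional SDP with diagonal-RP blocks is a relaxation. [folklore] -/
theorem wilson_mem_diagRpLevelValues_two_suN (hL : Even L) (h4 : 4 ≤ L) {i j : Fin 2} (hij : i ≠ j)
    (n : ℕ) (P : C(GaugeConfig 2 L (Matrix.specialUnitaryGroup (Fin N) ℂ), ℝ)) :
    ∫ U, P U ∂(wilsonMeasure (fundamentalRep (Fin N)) β) ∈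
      diagRpLevelValuesSuN (d := 2) (L := L) N β i j n P := by
  haveI : IsProbabilityMeasure (wilsonMeasure (d := 2) (L := L) (fundamentalRep (Fin N)) β) :=
    isProbabilityMeasure_wilsonMeasure (ρ := fundamentalRep (Fin N)) (continuous_fundamentalRep _) β
  refine ⟨expectationFunctional (wilsonMeasure (fundamentalRep (Fin N)) β),
    isBootstrapFeasible_wilson_suN N β _ rfl (wordTruncation_subset_polyAlgebra _ n),
    fun v _ hvH hvg => ?_, rfl⟩
  rw [expectationFunctional_apply]
  simpa only [ContinuousMap.mul_apply, ContinuousMap.comp_apply, diagSwapCM_apply] using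
    wilson_giDiagRP_real (fundamentalRep (Fin N))
      (DiagRPTwo.gaugeInvariantDiagonalRP_two_even_allBeta_suN hL h4 hij β) v hvH hvg

/-- ★★★ **Summary, `d = 2`** (`L ≥ 4` even, ANY real `β`, every `N`, every polynomial `P`, `ε > 0`):
the two-dimensional SDP with diagonal-RP cuts has a NONEMPTY feasible interval at every level
containing the Wilson value, and these intervals shrink to it — in contrast with
`diagRpLevelValues_eventually_eq_empty_suN` in dimension `≥ 3`. [folklore] -/
theorem diagCuts_two_sound_and_convergent_suN (hL : Even L) (h4 : 4 ≤ L) {i j : Fin 2} (hij : i ≠ j)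
    {P : C(GaugeConfig 2 L (Matrix.specialUnitaryGroup (Fin N) ℂ), ℝ)}
    (hP : P ∈ polyAlgebra (ι := Edge 2 L) (fundamentalLatticeRep N)) {ε : ℝ} (hε : 0 < ε) :
    (∀ n, ∫ U, P U ∂(wilsonMeasure (fundamentalRep (Fin N)) β) ∈
        diagRpLevelValuesSuN (d := 2) (L := L) N β i j n P) ∧
      ∀ᶠ n in atTop, diagRpLevelValuesSuN (d := 2) (L := L) N β i j n P ⊆
        Set.Icc (∫ U, P U ∂(wilsonMeasure (fundamentalRep (Fin N)) β) - ε)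
          (∫ U, P U ∂(wilsonMeasure (fundamentalRep (Fin N)) β) + ε) :=
  ⟨fun n => wilson_mem_diagRpLevelValues_two_suN N β hL h4 hij n P,
    diagRpLevelValues_subset_Icc_suN N β i j hP hε⟩

end TwoDim

end Summit.QuantumFields.GaugeBoot

end
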